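import Summits.QuantumFields.BalabanUV.T4Continuum.Support.VariationalTransfer
import Literature.MathematicalPhysics.QuantumFieldTheory.Balaban1983to89.T4GaugeActionRate
import Summits.QuantumFields.BalabanUV.T4Continuum.Support.VariationalOneStepSymbol

/-!
# T⁴ programme, spine node NE2 (U1a), lane P2 — the TYPED LEAVES of the variational route
# (`t4/skeletons/NE2-t4-ne2-p2.md` §2; cell `pub-balaban`, row NE2 co-owner #2, lineage t4-ne2-p2 gen 9)

HONEST FRAMING (T4-DAG p. 1): rung (B)+1 only — NOT infinite volume, NOT a mass gap, NOT Clay.  This module ASSERTS NOTHING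
new about Bałaban's objects: every `def … : Prop` is a LEAF STATEMENT of the skeleton (to be proved by the formalisation swarm
or marked open), the `structure … : Prop` of §3 is the HYPOTHESIS SHAPE of the background tier (asserted by nobody), and the
theorems are bookkeeping: (leaves) ⟹ (root) through the kernel-checked spine `Support/VariationalTransfer` (p206937).  Node NE2 is
NOT IN PRINT (cell GAPS G-t4-U1a-1).  HONEST DEPENDENCY (cell, verbatim): continuum YM on T⁴ ⇐ BetaPertH ∧ nine spine estimates
(0/9 proved); BetaPertH ⇐ (D1) ∧ (D4) ∧ CAP+tail; G-an2-4 gates asym, D1 and NE2/3/4.  No `sorry`; nothing printed is a hypothesis.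
-/

noncomputable section

namespace Summit.QuantumFields.BalabanUV.T4Continuum.VariationalLeaves

open scoped Matrix ComplexConjugate BigOperators
open Summit.QuantumFields.BalabanUV.T4Continuum.VariationalTransfer
open Literature.MathematicalPhysics.QuantumFieldTheory.Balaban1983to89
open Literature.MathematicalPhysics.QuantumFieldTheory.Balaban1983to89.B5Prop11Plancherel (Tor fine unitVec)
open Literature.MathematicalPhysics.QuantumFieldTheory.Balaban1983to89.B5Action121 (Fs)
open Literature.MathematicalPhysics.QuantumFieldTheory.Balaban1983to89.B5Block118 (QvOp)
open Literature.MathematicalPhysics.QuantumFieldTheory.Balaban1983to89.B5Hk163Torus (HkOp)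
open Literature.MathematicalPhysics.QuantumFieldTheory.Balaban1983to89.B4Strip (Delta1r)
open Literature.MathematicalPhysics.QuantumFieldTheory.Balaban1983to89.T4GaugeActionRate (xIn gam0)

variable {d : ℕ}

/-! ## §1 Tier 0 (`U = 1`) leaves -/

/-- **LEAF L0-ONE (one-step weighted symbol consistency; NEW, Fourier, finite alias sums over ONE level).**  For the block
side `L` and every momentum `p′` of the Brillouin zone, the inputs `x_κ = Δ₀(p′)φ_κ^{(L)}(p′)` of the (1.66) multiplier
([Balaban1984PropagatorsI] (1.62) p.28; tree `T4GaugeActionRate.xIn`) deviate from their `n = 1` value `1` (no averaging: the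
Wilson form itself) by at most `C·Δ₀(p′)` — relative consistency of the ONE-STEP effective action with the Wilson action at order
(lattice momentum)².  Through the tree's Lipschitz lemma `T4GaugeActionRate.w166_rate_of_phi162_rate L 1` it gives
`|w166 L μ ν p′ − w166 1 μ ν p′| ≤ 3γ₀⁻⁶·C·Δ₀(p′)`.  NOT PRINTED (the printed/tree rates compare `n` with `n′` uniformly,
without the weight `Δ₀`); expected size S. [folklore] -/
def OneStepWeightedPhi (d L : ℕ) (C : ℝ) : Prop :=
  ∀ s : Fin d → ℝ, (∀ ν, |s ν| ≤ Real.pi) → ∀ κ : Fin d, |xIn L s κ - 1| ≤ C * Delta1r 0 s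

/-- **LEAF L0-DICT (dictionary, tiny): at block side `n = 1` the inputs are identically `1`** (`u ≡ v_μ ≡ 1`, `Δ^{(1)} = Δ₀`), so
`w166 1` IS the transverse Wilson symbol and `blockSpin`'s `S⁰` is the (1.66) form at `n = 1`. [folklore] -/
def XInOne (d : ℕ) : Prop :=
  ∀ s : Fin d → ℝ, (∀ ν, |s ν| ≤ Real.pi) → (∃ ν₀, s ν₀ ≠ 0) → ∀ κ : Fin d, xIn 1 s κ = 1

/-- **LEAF L0-REG (L²-regularity / spectral concentration of the k-step minimiser; NEW, Fourier alias sums of (1.63)).**  The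
field strength `F = F[H_kB]` of Bałaban's minimiser ([Balaban1984PropagatorsI] (1.63) p.28, tree `B5Hk163Torus.HkOp`) varies by
`O(n⁻¹)` per lattice step in the mean square, uniformly in the block side `n ≥ 1`, the torus and `B`:
`Σ_{x,μ,ν,λ} |F_{μν}(x + e_λ) − F_{μν}(x)|² ≤ C_reg·n⁻²·Σ_{x,μ,ν} |F_{μν}(x)|²`.  (Printed model: the SUP-norm HÖLDER bound of
p. 28–29 «the sum over l of the absolute value of this expression multiplied by |∂v(p′+l)||p′+l|^α is bounded … This implies bounds
on (1/|x′−x|^α)|∂(H_kB)_μ(x′) − ∂(H_kB)_μ(x)|», α < 1; the L² statement with the full power is NOT printed.  Alias count: the energy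
density of `H_kB` at alias `l` is `≲ Π_{λ: l_λ≠0} l_λ⁻²·|l|⁻²`, the weight is `|l|²n⁻²`, and `Σ_l Π_{l_λ≠0} l_λ⁻² < ∞`.)  Numerics
(kit j086962, d = 2, L = 2, n = 2,4,8,16): `n²·(quotient) = 16.0, 21.3, 23.3, 23.8`.  Expected size M. [folklore] -/
def MinimiserRegularityL2 (d : ℕ) (Creg : ℝ) : Prop :=
  ∀ (n : ℕ) [NeZero n] (M : Fin d → ℕ) [∀ μ, NeZero (M μ)] (B : Tor M × Fin d → ℂ),
    ∑ x : Tor (fine n M), ∑ μ : Fin d, ∑ ν : Fin d, ∑ κ : Fin d,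
        ‖Fs (fine n M) (n : ℂ) (HkOp n M *ᵥ B) μ ν (x + unitVec (fine n M) κ)
          - Fs (fine n M) (n : ℂ) (HkOp n M *ᵥ B) μ ν x‖ ^ 2
      ≤ Creg / (n : ℝ) ^ 2 * ∑ x : Tor (fine n M), ∑ μ : Fin d, ∑ ν : Fin d, ‖Fs (fine n M) (n : ℂ) (HkOp n M *ᵥ B) μ ν x‖ ^ 2

/-- **LEAF L0-CONS = THE ONE HYPOTHESIS OF `VariationalTransfer.effAction_step_rate`** (one-step consistency on the minimiser,
block side `L`, constant `C₁`): `S¹(H_kB) ≤ (1 + C₁n⁻²)·S⁰(H_kB)` for every `n ≥ 1`, torus and `B`.  ASSEMBLED from L0-ONE ×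
L0-REG through the torus Plancherel dictionary for the (1.66) form (tree: `B5Hk163Form166`, `B6Cov2156Torus.deltaPol`;
one-step form = (1.66) at `n = L` over the η-lattice as unit lattice): `S¹(A) − S⁰(A) = Σ_{p′} ⟨Â, (W_L − W_1)Â⟩ ≤
3γ₀⁻⁶C·Σ_{p′} Δ₀(p′)·(energy density) ≤ 3γ₀⁻⁷C·C_reg·n⁻²·S⁰(A)` at `A = H_kB`.  NOT PRINTED. [folklore] -/
def OneStepConsistency (d L : ℕ) [NeZero L] (C₁ : ℝ) : Prop :=
  ∀ (n : ℕ) [NeZero n] (M : Fin d → ℕ) [∀ μ, NeZero (M μ)] (B : Tor M × Fin d → ℂ),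
    oneStepAction n L M (HkOp n M *ᵥ B) ≤ (1 + C₁ / (n : ℝ) ^ 2) * Sphys n M (HkOp n M *ᵥ B)

/-! ## §2 Tier-0 assembly (kernel): L0-CONS ⟹ the form-level η-rate of the effective action at every level, every torus -/

/-- **ROOT-0 (form level, `U = 1`) from the ONE leaf L0-CONS**: for every block side `n` (in the spine `n = L^k`), every torus and
every unit field `B`: `0 ≤ Δ_{k+1}(B) − Δ_k(B) ≤ (C₁/n²)·Δ_k(B)` — rate `θ = L^{−2}` in King's form `C₁·L^{−2k}`.  (The lower
bound is hypothesis-free: `VariationalTransfer.effAction_le_succ`.) [folklore] -/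
theorem effAction_rate_of_oneStepConsistency {L : ℕ} [NeZero L] {C₁ : ℝ} (h : OneStepConsistency d L C₁)
    (n : ℕ) [NeZero n] (M : Fin d → ℕ) [∀ μ, NeZero (M μ)] (B : Tor M × Fin d → ℂ) :
    0 ≤ effActionSucc n L M B - effAction n M B ∧
      effActionSucc n L M B - effAction n M B ≤ C₁ / (n : ℝ) ^ 2 * effAction n M B :=
  effAction_step_rate n L M B (h n M B)

/-- the same in King's shape at level `k` (`n = L^k`): `Δ_{k+1}(B) − Δ_k(B) ≤ C₁·(L^{−2})^k·Δ_k(B)`. [folklore] -/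
theorem effAction_rate_king {L : ℕ} [NeZero L] {C₁ : ℝ} (h : OneStepConsistency d L C₁)
    (k : ℕ) (M : Fin d → ℕ) [∀ μ, NeZero (M μ)] (B : Tor M × Fin d → ℂ) :
    haveI : NeZero (L ^ k) := ⟨pow_ne_zero k (NeZero.ne L)⟩
    0 ≤ effActionSucc (L ^ k) L M B - effAction (L ^ k) M B ∧
      effActionSucc (L ^ k) L M B - effAction (L ^ k) M B ≤ C₁ * (((L : ℝ) ^ 2)⁻¹) ^ k * effAction (L ^ k) M B := by
  haveI : NeZero (L ^ k) := ⟨pow_ne_zero k (NeZero.ne L)⟩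
  obtain ⟨h0, h1⟩ := effAction_rate_of_oneStepConsistency h (L ^ k) M B
  refine ⟨h0, h1.trans_eq ?_⟩
  congr 1
  rw [div_eq_mul_inv, inv_pow, ← pow_mul, Nat.cast_pow, pow_mul']

/-! ## §3 The background tier (NE2⁺, canonical pair) as a HYPOTHESIS SHAPE over abstract covariant data — asserted by nobody

For a fine background `U′` on the η/L-lattice and its one-step average `Ū′ = Q̄(U′)` on the η-lattice ([Balaban1985Averaging];
composition [Balaban1985BackgroundPropagators] (3.15) «Q_j(U) = Q(Ū^{j−1})…Q(Ū)Q(U)»): `Sc` = the quadratic (Hessian) form of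
the η-lattice action at `Ū′` ((3.23)-type covariant form), `Sf` = the same at `U′` one level finer, `Q₁ = Q(U′)` the linear covariant
one-step average, `Qk = Q_k(Ū′)`, `Hk` = the covariant k-step minimiser at `Ū′`.  The k-th and (k+1)-th background effective
actions are `Δ_k(Ū′) = blockSpin Qk Sc` and `Δ_{k+1}(U′) = blockSpin (Qk ∘ Q₁) Sf` — the SAME outer map, so only ONE-STEP objects
are compared (no NE3, no Neumann series in the background for the canonical pair). -/

/-- abstract covariant one-step data (carriers arbitrary; an instantiation supplies Bałaban's (3.13)–(3.15)/(3.23) objects or the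
tree's model-level covariant operators of `Support/AbelianCovariantLaplacian` / `ColourCovariantLaplacian`). [folklore] -/
structure CovariantStepData (V W Z : Type*) where
  /-- `dQ_k` at the averaged background `Ū′` (η-lattice fields → unit-lattice fields) -/
  Qk : W → Z
  /-- `dQ` at `U′` (η/L-lattice fields → η-lattice fields) -/
  Q₁ : V → W
  /-- the covariant quadratic form at `Ū′` on η-lattice fields -/
  Sc : W → ℝ
  /-- the covariant quadratic form at `U′` on η/L-lattice fields -/
  Sf : V → ℝ
  /-- the covariant k-step minimiser at `Ū′` -/
  Hk : Z → W

/-- **THE THREE BACKGROUND LEAVES AS ONE HYPOTHESIS SHAPE** (NOT PRINTED, asserted by nobody): `federbush` = L⁺-FED (covariant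
Federbush with factor `1 + μ`; printed models: [Federbush1986PhaseCellI] (0.12) abelian, [Balaban1985Averaging] Props. 5–9 for
the non-linear averages), `minimiser` = L⁺-VAR (existence/minimality of the covariant constrained minimiser — the structure of
[Balaban1985BackgroundPropagators] (3.23)–(3.24) / [Balaban1985Variational]), `consistent` = L⁺-ONE × L⁺-REG (covariant one-step
consistency on the minimiser with `ε`; printed model: the local gauge reduction of [Balaban1985BackgroundPropagators] p.399,
(3.50)–(3.53)).  For the T⁴ spine's unit-scale-smooth backgrounds the leaves are to be proved with `μ_k = c_F·α·L^{2−2k}`,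
`ε_k = C₁·L^{−2k}(1 + c·α)`. [folklore] -/
structure CovariantStepLaws {V W Z : Type*} (D : CovariantStepData V W Z) (μ ε : ℝ) : Prop where
  surj : Function.Surjective D.Q₁
  Sc_nonneg : ∀ A, 0 ≤ D.Sc A
  Sf_nonneg : ∀ A', 0 ≤ D.Sf A'
  μ_nonneg : 0 ≤ μ
  federbush : ∀ A', D.Sc (D.Q₁ A') ≤ (1 + μ) * D.Sf A'
  minimiser : ∀ B, D.Qk (D.Hk B) = B ∧ ∀ A₁, D.Qk A₁ = B → D.Sc (D.Hk B) ≤ D.Sc A₁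
  consistent : ∀ B, blockSpin D.Q₁ D.Sf (D.Hk B) ≤ (1 + ε) * D.Sc (D.Hk B)

/-- **NE2⁺ (canonical pair) for the effective-action species, kernel-checked modulo the shape**: under `CovariantStepLaws D μ ε`,
`Δ_k(Ū′)(B) ≤ (1 + μ)·Δ_{k+1}(U′)(B)` and `Δ_{k+1}(U′)(B) ≤ (1 + ε)·Δ_k(Ū′)(B)` for every unit field `B` — by
`VariationalTransfer.step_sandwich`.  Nothing of NE3 (node U1b) is used for the canonical pair. [folklore] -/
theorem covariant_step_sandwich {V W Z : Type*} {D : CovariantStepData V W Z} {μ ε : ℝ} (h : CovariantStepLaws D μ ε) (B : Z) :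
    blockSpin D.Qk D.Sc B ≤ (1 + μ) * blockSpin (D.Qk ∘ D.Q₁) D.Sf B ∧
      blockSpin (D.Qk ∘ D.Q₁) D.Sf B ≤ (1 + ε) * blockSpin D.Qk D.Sc B :=
  step_sandwich h.surj h.Sc_nonneg h.Sf_nonneg h.μ_nonneg h.federbush (h.minimiser B).1 (h.minimiser B).2 (h.consistent B)

/-- the two-sided RELATIVE bound in difference form: `|Δ_{k+1}(U′)(B) − Δ_k(Ū′)(B)| ≤ max(ε, μ)·max(Δ_k, Δ_{k+1})` — stated as the
pair of one-sided differences the op-norm adapter consumes. [folklore] -/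
theorem covariant_step_diff {V W Z : Type*} {D : CovariantStepData V W Z} {μ ε : ℝ} (h : CovariantStepLaws D μ ε) (B : Z) :
    blockSpin (D.Qk ∘ D.Q₁) D.Sf B - blockSpin D.Qk D.Sc B ≤ ε * blockSpin D.Qk D.Sc B ∧
      blockSpin D.Qk D.Sc B - blockSpin (D.Qk ∘ D.Q₁) D.Sf B ≤ μ * blockSpin (D.Qk ∘ D.Q₁) D.Sf B := by
  obtain ⟨h₁, h₂⟩ := covariant_step_sandwich h B
  constructor <;> linarith

/-! ## §4 (v1.1) Leaf L0-ONE: the corrected statement and its PROOF (`Support/VariationalOneStepSymbol`) -/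

/-- **v1's `OneStepWeightedPhi` is MIS-TYPED at the zero mode** (recorded, not hidden): at `s = 0` the inputs vanish
(`xIn L 0 κ = Δ₀(0)·φ = 0`), so `|0 − 1| ≤ C·Δ₀(0) = 0` fails — the statement must exclude the zero momentum (the punctured
Brillouin zone of every printed bound, cf. `T4GaugeActionRate.xIn_mem_box`).  Witness for `d ≥ 1`. [folklore] -/
theorem not_oneStepWeightedPhi {d : ℕ} (hd : 1 ≤ d) (L : ℕ) (C : ℝ) : ¬ OneStepWeightedPhi d L C := by
  intro h
  have hπ : ∀ ν : Fin d, |(0 : Fin d → ℝ) ν| ≤ Real.pi := fun ν => by simp [Real.pi_pos.le]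
  have := h 0 hπ ⟨0, hd⟩
  have hΔ : Delta1r 0 (0 : Fin d → ℝ) = 0 := by simp [Delta1r, Literature.MathematicalPhysics.QuantumFieldTheory.Balaban1983to89.B4Strip.S1r]
  have hx : xIn L (0 : Fin d → ℝ) ⟨0, hd⟩ = 0 := by
    unfold xIn; rw [hΔ, zero_mul]
  rw [hx, hΔ] at this
  norm_num at this

/-- **LEAF L0-ONE, CORRECTED STATEMENT** (supersedes v1's `OneStepWeightedPhi`): on the PUNCTURED Brillouin zone,
`|Δ₀(p′)φ_κ^{(L)}(p′) − 1| ≤ C·Δ₀(p′)`. [folklore] -/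
def OneStepWeightedPhi' (d L : ℕ) (C : ℝ) : Prop :=
  ∀ s : Fin d → ℝ, (∀ ν, |s ν| ≤ Real.pi) → (∃ ν₀, s ν₀ ≠ 0) → ∀ κ : Fin d, |xIn L s κ - 1| ≤ C * Delta1r 0 s

/-- **LEAF L0-ONE IS PROVED** with `C = π⁴/64`, for EVERY block side `L ≥ 1` and every `d`:
`Support/VariationalOneStepSymbol.abs_xIn_sub_one_le`. [folklore] -/
theorem oneStepWeightedPhi'_holds (d L : ℕ) [NeZero L] (hL : 1 ≤ L) : OneStepWeightedPhi' d L (Real.pi ^ 4 / 64) :=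
  fun s hs ⟨ν₀, hν₀⟩ κ => VariationalOneStepSymbol.abs_xIn_sub_one_le L hL s hs ν₀ hν₀ κ

/-- **DICTIONARY LEAF `XInOne` PROVED**: at block side `1` (no averaging) the inputs are identically `1` on the punctured zone,
so `w166 1` is the Wilson transverse symbol. [folklore] -/
theorem xInOne_holds (d : ℕ) : XInOne d := by
  intro s hs hν κ
  obtain ⟨ν₀, hν₀⟩ := hν
  have hU : ∀ x : ℝ, |x| ≤ Real.pi → B4Strip.uFactorr 1 0 x = 1 := by
    intro x hx
    unfold B4Strip.uFactorr
    rw [if_pos rfl]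
    by_cases hx0 : x = 0
    · rw [if_pos hx0]
    · rw [if_neg hx0]
      have hpos : 0 < B4Strip.Sxir 1 x := B4Strip.Sxir_pos 1 le_rfl x hx0 hx
      have hS : B4Strip.Sxir 1 x = B4Strip.S1r x := by unfold B4Strip.Sxir B4Strip.S1r; simp
      rw [← hS]
      exact div_self hpos.ne'
  have hUr : B4Strip.Ur 1 (fun _ => (0 : Fin 1)) s = 1 := by
    unfold B4Strip.Ur
    exact Finset.prod_eq_one fun μ _ => by simpa using hU (s μ) (hs μ)
  have hD : B4Strip.DeltaXir 1 0 (B4Strip.shiftr 1 (fun _ => (0 : Fin 1)) s) = Delta1r 0 s := by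
    rw [B5Prop11Leaves.shiftr_zero]
    unfold B4Strip.DeltaXir Delta1r B4Strip.Sxir B4Strip.S1r
    simp
  have hΔ : 0 < Delta1r 0 s := B5Prop11Leaves.Delta1r_pos s hs ν₀ hν₀
  have huniv : (Finset.univ : Finset (Fin d → Fin 1)) = {fun _ => 0} :=
    Finset.eq_singleton_iff_unique_mem.2 ⟨Finset.mem_univ _, fun k _ => Subsingleton.elim _ _⟩
  unfold xIn
  rw [B5Bounds167Lattice.phi162_eq 1 le_rfl κ s hs, huniv, Finset.sum_singleton, hUr, hD]
  have hκ : B4Strip.uFactorr 1 ((fun _ => (0 : Fin 1)) κ : ℕ) (s κ) = 1 := by simpa using hU (s κ) (hs κ)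
  rw [hκ]
  field_simp

end Summit.QuantumFields.BalabanUV.T4Continuum.VariationalLeaves
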